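import Literature.NumberTheory.EllipticCurves.CongruentNumberOddMonskySelmerBound
import HarnessLib

/-!
# Monsky's `det M = 1` cells WITHOUT Monsky's named fact: `#Sel⁽²⁾(E_n/ℚ) = 4`, rank `E_n(ℚ) = 0` and `Ш(E_n)[2^∞] = 0`
# UNCONDITIONALLY for every square-free `n` (odd or even) whose Monsky matrix is invertible over `𝔽₂`

Topic `NumberTheory/EllipticCurves`; namespace `Literature.NumberTheory.EllipticCurves.CongruentNumberMonskySelmer`.
A pure proof file (theorems only).

The tree's `HeathBrown1994/CongruentTwoSelmerMonskyMatrix.lean` turns the census word «`s(n) = 0`» into the decidable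
shape `det M = 1` (`M` Monsky's matrix, odd or even case) and — MODULO Monsky's theorem as a named fact `hM` — into
`#Sel₂(E_n) = 4`, the hypothesis of Smith 2016 Cor. 1.3 / of the journal door (Burungale–Tian 2026 + Deuring–Hecke +
Burungale–Flach 2024) for RANK ∧ SHAFIN ∧ LEAD and `BSD(E_n, ℓ)` at every prime. With the UPPER-BOUND halves of
Monsky's formula now tree theorems (`card_selmerGroup_two_le_pow_monskySelmerRank{Odd,Even}`,
`CongruentNumber{Odd,Even}MonskySelmerBound.lean`) the binder `hM` disappears:

* `card_selmerGroup_two_eq_four_of_le_four` — for `E_N`, `#Sel₂ ≤ 4` forces `#Sel₂ = 4` (the descent count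
  `#Sel₂ = 2^{rk}·#E(ℚ)[2]·#(Ш ⊓ H¹[2])` with `#E_N(ℚ)[2] = 4`, Silverman X.4.2);
* **`card_selmerGroup_two_eq_four_of_det_odd/even`** — `det M = 1 ⟹ #Sel₂(E_n) = 4`, and hence (Smith2016 file's kernel
  lemmas) **`mordellWeilRank_eq_zero_of_det_odd/even`**, **`primaryComponent_sha_two_eq_bot_of_det_odd/even`** —
  ALL UNCONDITIONAL: every square-free `n` with an invertible Monsky matrix has rank `0` and `Ш(E_n)[2^∞] = 0`
  (e.g. every prime `p ≡ 3 (mod 8)`, `n = 1, 2, 3, 6, 10, 11, 19, 33, 35, 42, 43, …`; the rank-`0` half is classical —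
  Genocchi / Knapp Prop. 4.23 —, the `Ш[2^∞] = 0` half was displayed on `hM` so far);
* the doors of the matrix file with `hM` STRUCK: `bsdTriple_of_smith_odd/even_descent` (Smith Cor. 1.3 as the only binder),
  `bsdTriple_of_BT_BF_odd/even_descent` and `forall_bsdp_of_BT_BF_odd/even_descent` (the three JOURNAL facts as the only
  binders), and the showcase `E₃ : y² = x³ − 9x`: rank `0` ∧ `Ш[2^∞] = 0` unconditionally
  (`rank_zero_sha_two_congruentNumberCurve_three`), BSD triple modulo the journal facts only.

Everything proved here is unconditional except where a named fact is an explicit binder; nothing about any census class is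
booked by this file. Cells `bsd-monsky` (prover-B) / sub-lane «bsd-p2» (the `s(n) = 0` membership `det M = 1` is now a
kernel certificate of `rank 0 ∧ Ш[2^∞] = 0` per `n`, fact-free).

## References

* [HeathBrown1994SelmerCongruentII] D. R. Heath-Brown, Invent. Math. 118 (1994) 331–370, appendix by P. Monsky: typescript
  p. 39 L10–L33 (odd), p. 41 L20–L36 (even); §1 p. 1 L14–L20, p. 6 L26–L28 (`s(D) = 0` for primes `D ≡ 3 (mod 8)`).
* [SilvermanAEC2009] J. H. Silverman, *The Arithmetic of Elliptic Curves*, 2nd ed., Thm. X.4.2, Prop. X.1.4.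
* [Smith2016CongruentDensity] A. Smith, arXiv:1603.08479, Cor. 1.3.
* [BurungaleTian2026] A. Burungale, Y. Tian, Ann. of Math. (2) 203 (2026), Thm. 1.1. [BurungaleFlach2024] A. Burungale,
  M. Flach, Camb. J. Math. 12 (2024), Thm. 1.1, Cor. 2. [Miller2011LMS] R. L. Miller, Def. 1.1.
* [Knapp1993] A. W. Knapp, *Elliptic Curves*, Prop. 4.23 (rank `0` for primes `≡ 3 (mod 8)`).
-/

noncomputable section

open scoped Classical

open WeierstrassCurve Literature.NumberTheory.EllipticCurves.HeathBrown1994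

namespace Literature.NumberTheory.EllipticCurves

namespace CongruentNumberMonskySelmer

/-! ## §1 `#Sel₂(E_N) ≤ 4` forces `#Sel₂(E_N) = 4` -/

/-- **`#Sel⁽²⁾(E_N/ℚ) ≤ 4 ⟹ #Sel⁽²⁾(E_N/ℚ) = 4`**: the descent count `#Sel₂ = 2^{rk}·#E_N(ℚ)[2]·#(Ш ⊓ H¹[2])` (Silverman X.4.2,
tree theorem `natCard_selmerGroup_eq`) with `#E_N(ℚ)[2] = 4` makes `#Sel₂` a positive multiple of `4`.
[cite: SilvermanAEC2009, Thm. X.4.2] -/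
theorem card_selmerGroup_two_eq_four_of_le_four {N : ℕ} (hN : N ≠ 0)
    (hle : Nat.card ((congruentNumberCurve N).selmerGroup 2) ≤ 4) :
    Nat.card ((congruentNumberCurve N).selmerGroup 2) = 4 := by
  haveI := isElliptic_congruentNumberCurve hN
  haveI : Fact (Nat.Prime 2) := ⟨Nat.prime_two⟩
  have hle' : Nat.card ((congruentNumberCurve N).selmerGroup ((2 : ℕ) : ℤ)) ≤ 4 := by
    simpa only [Nat.cast_ofNat] using hle
  haveI : Finite ((congruentNumberCurve N).sha ⊓ AddSubgroup.torsionBy (congruentNumberCurve N).galH1 ((2 : ℕ) : ℤ) :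
      AddSubgroup (congruentNumberCurve N).galH1) := by
    haveI : Finite ((congruentNumberCurve N).selmerGroup ((2 : ℕ) : ℤ)) :=
      (congruentNumberCurve N).finite_selmerGroup_holds (by norm_num)
    exact Nat.finite_of_card_ne_zero (fun h0 => by
      have hcard := (congruentNumberCurve N).natCard_selmerGroup_eq (n := 2) two_ne_zero
      rw [h0, mul_zero] at hcard
      exact (Nat.card_pos (α := (congruentNumberCurve N).selmerGroup ((2 : ℕ) : ℤ))).ne' hcard)
  have hS : 0 < Nat.card ((congruentNumberCurve N).sha ⊓
      AddSubgroup.torsionBy (congruentNumberCurve N).galH1 ((2 : ℕ) : ℤ) : AddSubgroup (congruentNumberCurve N).galH1) :=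
    Nat.card_pos
  have hcard := (congruentNumberCurve N).natCard_selmerGroup_eq (n := 2) two_ne_zero
  have aux : ∀ {C R T S : ℕ}, C = R * T * S → T = 4 → 0 < R → 0 < S → C ≤ 4 → C = 4 := by
    intro C R T S hC hT hR hS h4
    subst hT; subst hC
    nlinarith
  have key := aux hcard (by convert Smith2016.natCard_torsionBy_two_congruentNumberCurve hN; norm_num)
    (pow_pos two_pos _) hS hle'
  simpa only [Nat.cast_ofNat] using key

/-! ## §2 `det M = 1` ⟹ `#Sel₂ = 4`, rank `0`, `Ш[2^∞] = 0` — unconditionally -/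

variable {k : ℕ} (p : Fin k → ℕ)

/-- **Odd `n = p₁⋯p_k`, `det M = 1` ⟹ `#Sel⁽²⁾(E_n/ℚ) = 4`, UNCONDITIONALLY** (Monsky's odd formula, upper bound, a tree theorem;
`s(n) = 0`; `#Sel₂ ≥ 4` from the descent count). [cite: HeathBrown1994SelmerCongruentII, Appendix (Monsky), typescript p. 39 L10–L33]
[cite: SilvermanAEC2009, Thm. X.4.2] -/
theorem card_selmerGroup_two_eq_four_of_det_odd (hp : ∀ i, (p i).Prime) (hodd : ∀ i, Odd (p i))
    (hinj : Function.Injective p) (hdet : (monskyMatrixOdd p).det = 1) :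
    Nat.card ((congruentNumberCurve (∏ i, p i)).selmerGroup 2) = 4 := by
  have h := card_selmerGroup_two_le_pow_monskySelmerRankOdd k p hp hodd hinj
  rw [monskySelmerRankOdd_eq_zero_of_det p hdet] at h
  exact card_selmerGroup_two_eq_four_of_le_four (Squarefree.ne_zero (squarefree_prod_of_injective p hp hinj)) h

/-- **Even `n = 2p₁⋯p_k`, `det M = 1` ⟹ `#Sel⁽²⁾(E_n/ℚ) = 4`, UNCONDITIONALLY.**
[cite: HeathBrown1994SelmerCongruentII, Appendix (Monsky), typescript p. 41 L20–L36] [cite: SilvermanAEC2009, Thm. X.4.2] -/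
theorem card_selmerGroup_two_eq_four_of_det_even (hp : ∀ i, (p i).Prime) (hodd : ∀ i, Odd (p i))
    (hinj : Function.Injective p) (hdet : (monskyMatrixEven p).det = 1) :
    Nat.card ((congruentNumberCurve (2 * ∏ i, p i)).selmerGroup 2) = 4 := by
  have h := card_selmerGroup_two_le_pow_monskySelmerRankEven k p hp hodd hinj
  rw [monskySelmerRankEven_eq_zero_of_det p hdet] at h
  exact card_selmerGroup_two_eq_four_of_le_four
    (Squarefree.ne_zero (squarefree_two_mul_prod_of_injective p hp hodd hinj)) h

/-- `N`-form of `card_selmerGroup_two_eq_four_of_det_odd` (`∏ pᵢ = N`). [cite: HeathBrown1994SelmerCongruentII, Appendix (Monsky), typescript p. 39 L10–L33] -/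
theorem card_selmerGroup_two_eq_four_of_det_odd' {N : ℕ} (hn : ∏ i, p i = N) (hp : ∀ i, (p i).Prime)
    (hodd : ∀ i, Odd (p i)) (hinj : Function.Injective p) (hdet : (monskyMatrixOdd p).det = 1) :
    Nat.card ((congruentNumberCurve N).selmerGroup 2) = 4 := by
  subst hn; exact card_selmerGroup_two_eq_four_of_det_odd p hp hodd hinj hdet

/-- `N`-form of `card_selmerGroup_two_eq_four_of_det_even` (`2 ∏ pᵢ = N`). [cite: HeathBrown1994SelmerCongruentII, Appendix (Monsky), typescript p. 41 L20–L36] -/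
theorem card_selmerGroup_two_eq_four_of_det_even' {N : ℕ} (hn : 2 * ∏ i, p i = N) (hp : ∀ i, (p i).Prime)
    (hodd : ∀ i, Odd (p i)) (hinj : Function.Injective p) (hdet : (monskyMatrixEven p).det = 1) :
    Nat.card ((congruentNumberCurve N).selmerGroup 2) = 4 := by
  subst hn; exact card_selmerGroup_two_eq_four_of_det_even p hp hodd hinj hdet

/-- **Odd `n`, `det M = 1` ⟹ `rk E_n(ℚ) = 0`, unconditionally.** [cite: HeathBrown1994SelmerCongruentII, §1 typescript p. 1 L18–L20 ("r(D) ≤ s(D)")]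
[cite: SilvermanAEC2009, Thm. X.4.2] -/
theorem mordellWeilRank_eq_zero_of_det_odd (hp : ∀ i, (p i).Prime) (hodd : ∀ i, Odd (p i))
    (hinj : Function.Injective p) (hdet : (monskyMatrixOdd p).det = 1) :
    haveI := isElliptic_congruentNumberCurve (Squarefree.ne_zero (squarefree_prod_of_injective p hp hinj))
    (congruentNumberCurve (∏ i, p i)).mordellWeilRank = 0 :=
  Smith2016.mordellWeilRank_eq_zero_of_card_selmerGroup_two
    (Squarefree.ne_zero (squarefree_prod_of_injective p hp hinj))
    (card_selmerGroup_two_eq_four_of_det_odd p hp hodd hinj hdet)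

/-- **Even `n`, `det M = 1` ⟹ `rk E_n(ℚ) = 0`, unconditionally.** [cite: HeathBrown1994SelmerCongruentII, §1 typescript p. 1 L18–L20]
[cite: SilvermanAEC2009, Thm. X.4.2] -/
theorem mordellWeilRank_eq_zero_of_det_even (hp : ∀ i, (p i).Prime) (hodd : ∀ i, Odd (p i))
    (hinj : Function.Injective p) (hdet : (monskyMatrixEven p).det = 1) :
    haveI := isElliptic_congruentNumberCurve (Squarefree.ne_zero (squarefree_two_mul_prod_of_injective p hp hodd hinj))
    (congruentNumberCurve (2 * ∏ i, p i)).mordellWeilRank = 0 :=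
  Smith2016.mordellWeilRank_eq_zero_of_card_selmerGroup_two
    (Squarefree.ne_zero (squarefree_two_mul_prod_of_injective p hp hodd hinj))
    (card_selmerGroup_two_eq_four_of_det_even p hp hodd hinj hdet)

/-- **Odd `n`, `det M = 1` ⟹ `Ш(E_n)[2^∞] = 0`, unconditionally.** [cite: HeathBrown1994SelmerCongruentII, Appendix (Monsky), typescript p. 39 L10–L33]
[cite: SilvermanAEC2009, Thm. X.4.2] -/
theorem primaryComponent_sha_two_eq_bot_of_det_odd (hp : ∀ i, (p i).Prime) (hodd : ∀ i, Odd (p i))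
    (hinj : Function.Injective p) (hdet : (monskyMatrixOdd p).det = 1) :
    haveI := isElliptic_congruentNumberCurve (Squarefree.ne_zero (squarefree_prod_of_injective p hp hinj))
    AddCommGroup.primaryComponent (congruentNumberCurve (∏ i, p i)).sha 2 = ⊥ :=
  Smith2016.primaryComponent_sha_two_eq_bot_of_card_selmerGroup_two
    (Squarefree.ne_zero (squarefree_prod_of_injective p hp hinj))
    (card_selmerGroup_two_eq_four_of_det_odd p hp hodd hinj hdet)

/-- **Even `n`, `det M = 1` ⟹ `Ш(E_n)[2^∞] = 0`, unconditionally.** [cite: HeathBrown1994SelmerCongruentII, Appendix (Monsky), typescript p. 41 L20–L36]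
[cite: SilvermanAEC2009, Thm. X.4.2] -/
theorem primaryComponent_sha_two_eq_bot_of_det_even (hp : ∀ i, (p i).Prime) (hodd : ∀ i, Odd (p i))
    (hinj : Function.Injective p) (hdet : (monskyMatrixEven p).det = 1) :
    haveI := isElliptic_congruentNumberCurve (Squarefree.ne_zero (squarefree_two_mul_prod_of_injective p hp hodd hinj))
    AddCommGroup.primaryComponent (congruentNumberCurve (2 * ∏ i, p i)).sha 2 = ⊥ :=
  Smith2016.primaryComponent_sha_two_eq_bot_of_card_selmerGroup_two
    (Squarefree.ne_zero (squarefree_two_mul_prod_of_injective p hp hodd hinj))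
    (card_selmerGroup_two_eq_four_of_det_even p hp hodd hinj hdet)

/-! ## §3 The doors of the matrix file with Monsky's fact struck -/

/-- **The Smith door, odd `n`, WITHOUT Monsky's fact**: Smith 2016 Cor. 1.3 (`hS`) + `det M = 1` ⟹ RANK ∧ SHAFIN ∧ LEAD, rank `0`,
analytic rank `0`. [cite: Smith2016CongruentDensity, Cor. 1.3 (arXiv:1603.08479 chunk p0003 L39–L44)]
[cite: HeathBrown1994SelmerCongruentII, Appendix (Monsky), typescript p. 39 L10–L33] -/
theorem bsdTriple_of_smith_odd_descent (hS : Smith2016.cor13_bsd_of_selmerRankTwo) (hp : ∀ i, (p i).Prime)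
    (hodd : ∀ i, Odd (p i)) (hinj : Function.Injective p) (hdet : (monskyMatrixOdd p).det = 1) :
    haveI := isElliptic_congruentNumberCurve (Squarefree.ne_zero (squarefree_prod_of_injective p hp hinj))
    haveI := isGloballyMinimal_congruentNumberCurve (squarefree_prod_of_injective p hp hinj)
    (congruentNumberCurve (∏ i, p i)).BSDTriple ∧ (congruentNumberCurve (∏ i, p i)).mordellWeilRank = 0 ∧
      (congruentNumberCurve (∏ i, p i)).analyticRank = 0 :=
  Smith2016.bsdTriple_congruentNumberCurve_of_cor13 hS (squarefree_prod_of_injective p hp hinj)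
    (card_selmerGroup_two_eq_four_of_det_odd p hp hodd hinj hdet)

/-- **The Smith door, even `n`, WITHOUT Monsky's fact.** [cite: Smith2016CongruentDensity, Cor. 1.3]
[cite: HeathBrown1994SelmerCongruentII, Appendix (Monsky), typescript p. 41 L20–L36] -/
theorem bsdTriple_of_smith_even_descent (hS : Smith2016.cor13_bsd_of_selmerRankTwo) (hp : ∀ i, (p i).Prime)
    (hodd : ∀ i, Odd (p i)) (hinj : Function.Injective p) (hdet : (monskyMatrixEven p).det = 1) :
    haveI := isElliptic_congruentNumberCurve (Squarefree.ne_zero (squarefree_two_mul_prod_of_injective p hp hodd hinj))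
    haveI := isGloballyMinimal_congruentNumberCurve (squarefree_two_mul_prod_of_injective p hp hodd hinj)
    (congruentNumberCurve (2 * ∏ i, p i)).BSDTriple ∧ (congruentNumberCurve (2 * ∏ i, p i)).mordellWeilRank = 0 ∧
      (congruentNumberCurve (2 * ∏ i, p i)).analyticRank = 0 :=
  Smith2016.bsdTriple_congruentNumberCurve_of_cor13 hS (squarefree_two_mul_prod_of_injective p hp hodd hinj)
    (card_selmerGroup_two_eq_four_of_det_even p hp hodd hinj hdet)

/-- **Journal door, odd `n`, WITHOUT Monsky's fact**: `det M = 1` + Burungale–Tian 2026 Thm. 1.1 (`hBT`), Deuring–Hecke (`hH`),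
Burungale–Flach 2024 (`hBF`) ⟹ RANK ∧ SHAFIN ∧ LEAD, rank `0`, analytic rank `0`, and `Ш[2^∞] = 0` (the last unconditionally).
[cite: BurungaleTian2026, Thm. 1.1] [cite: BurungaleFlach2024, Thm. 1.1 and Cor. 2]
[cite: HeathBrown1994SelmerCongruentII, Appendix (Monsky), typescript p. 39 L10–L33] -/
theorem bsdTriple_of_BT_BF_odd_descent
    (hBT : burungaleTian_analyticRank_eq_zero_of_selmerCorank_eq_zero_of_hasCM)
    (hH : hasEntireLFunction_of_j_mem_maximalCMJInvariants)
    (hBF : bsdTriple_of_hasCM_of_L_one_ne_zero) (hp : ∀ i, (p i).Prime) (hodd : ∀ i, Odd (p i))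
    (hinj : Function.Injective p) (hdet : (monskyMatrixOdd p).det = 1) :
    haveI := isElliptic_congruentNumberCurve (Squarefree.ne_zero (squarefree_prod_of_injective p hp hinj))
    haveI := isGloballyMinimal_congruentNumberCurve (squarefree_prod_of_injective p hp hinj)
    ((congruentNumberCurve (∏ i, p i)).BSDTriple ∧ (congruentNumberCurve (∏ i, p i)).mordellWeilRank = 0 ∧
      (congruentNumberCurve (∏ i, p i)).analyticRank = 0) ∧
      AddCommGroup.primaryComponent (congruentNumberCurve (∏ i, p i)).sha 2 = ⊥ :=
  ⟨bsdTriple_of_smith_odd_descent p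
      (Smith2016.cor13_bsd_of_selmerRankTwo_of_burungaleTian_of_burungaleFlach hBT hH hBF) hp hodd hinj hdet,
    primaryComponent_sha_two_eq_bot_of_det_odd p hp hodd hinj hdet⟩

/-- **Journal door, even `n`, WITHOUT Monsky's fact.** [cite: BurungaleTian2026, Thm. 1.1] [cite: BurungaleFlach2024, Thm. 1.1 and Cor. 2]
[cite: HeathBrown1994SelmerCongruentII, Appendix (Monsky), typescript p. 41 L20–L36] -/
theorem bsdTriple_of_BT_BF_even_descent
    (hBT : burungaleTian_analyticRank_eq_zero_of_selmerCorank_eq_zero_of_hasCM)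
    (hH : hasEntireLFunction_of_j_mem_maximalCMJInvariants)
    (hBF : bsdTriple_of_hasCM_of_L_one_ne_zero) (hp : ∀ i, (p i).Prime) (hodd : ∀ i, Odd (p i))
    (hinj : Function.Injective p) (hdet : (monskyMatrixEven p).det = 1) :
    haveI := isElliptic_congruentNumberCurve (Squarefree.ne_zero (squarefree_two_mul_prod_of_injective p hp hodd hinj))
    haveI := isGloballyMinimal_congruentNumberCurve (squarefree_two_mul_prod_of_injective p hp hodd hinj)
    ((congruentNumberCurve (2 * ∏ i, p i)).BSDTriple ∧ (congruentNumberCurve (2 * ∏ i, p i)).mordellWeilRank = 0 ∧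
      (congruentNumberCurve (2 * ∏ i, p i)).analyticRank = 0) ∧
      AddCommGroup.primaryComponent (congruentNumberCurve (2 * ∏ i, p i)).sha 2 = ⊥ :=
  ⟨bsdTriple_of_smith_even_descent p
      (Smith2016.cor13_bsd_of_selmerRankTwo_of_burungaleTian_of_burungaleFlach hBT hH hBF) hp hodd hinj hdet,
    primaryComponent_sha_two_eq_bot_of_det_even p hp hodd hinj hdet⟩

/-- **`BSD(E_n, ℓ)` for every prime `ℓ` on the journal door WITHOUT Monsky's fact**, odd `n`.
[cite: BurungaleTian2026, Thm. 1.1] [cite: BurungaleFlach2024, Thm. 1.1 and Cor. 2] [cite: Miller2011LMS, §1 and Def. 1.1] -/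
theorem forall_bsdp_of_BT_BF_odd_descent
    (hBT : burungaleTian_analyticRank_eq_zero_of_selmerCorank_eq_zero_of_hasCM)
    (hH : hasEntireLFunction_of_j_mem_maximalCMJInvariants)
    (hBF : bsdTriple_of_hasCM_of_L_one_ne_zero) (hp : ∀ i, (p i).Prime) (hodd : ∀ i, Odd (p i))
    (hinj : Function.Injective p) (hdet : (monskyMatrixOdd p).det = 1) (ℓ : ℕ) (hℓ : ℓ.Prime) :
    haveI := isElliptic_congruentNumberCurve (Squarefree.ne_zero (squarefree_prod_of_injective p hp hinj))
    haveI := isGloballyMinimal_congruentNumberCurve (squarefree_prod_of_injective p hp hinj)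
    BSDp (congruentNumberCurve (∏ i, p i)) ℓ :=
  haveI := isElliptic_congruentNumberCurve (Squarefree.ne_zero (squarefree_prod_of_injective p hp hinj))
  haveI := isGloballyMinimal_congruentNumberCurve (squarefree_prod_of_injective p hp hinj)
  forall_bsdp_of_bsdTriple' _ (bsdTriple_of_BT_BF_odd_descent p hBT hH hBF hp hodd hinj hdet).1.1 ℓ hℓ

/-- **`BSD(E_n, ℓ)` for every prime `ℓ` on the journal door WITHOUT Monsky's fact**, even `n`.
[cite: BurungaleTian2026, Thm. 1.1] [cite: BurungaleFlach2024, Thm. 1.1 and Cor. 2] [cite: Miller2011LMS, §1 and Def. 1.1] -/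
theorem forall_bsdp_of_BT_BF_even_descent
    (hBT : burungaleTian_analyticRank_eq_zero_of_selmerCorank_eq_zero_of_hasCM)
    (hH : hasEntireLFunction_of_j_mem_maximalCMJInvariants)
    (hBF : bsdTriple_of_hasCM_of_L_one_ne_zero) (hp : ∀ i, (p i).Prime) (hodd : ∀ i, Odd (p i))
    (hinj : Function.Injective p) (hdet : (monskyMatrixEven p).det = 1) (ℓ : ℕ) (hℓ : ℓ.Prime) :
    haveI := isElliptic_congruentNumberCurve (Squarefree.ne_zero (squarefree_two_mul_prod_of_injective p hp hodd hinj))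
    haveI := isGloballyMinimal_congruentNumberCurve (squarefree_two_mul_prod_of_injective p hp hodd hinj)
    BSDp (congruentNumberCurve (2 * ∏ i, p i)) ℓ :=
  haveI := isElliptic_congruentNumberCurve (Squarefree.ne_zero (squarefree_two_mul_prod_of_injective p hp hodd hinj))
  haveI := isGloballyMinimal_congruentNumberCurve (squarefree_two_mul_prod_of_injective p hp hodd hinj)
  forall_bsdp_of_bsdTriple' _ (bsdTriple_of_BT_BF_even_descent p hBT hH hBF hp hodd hinj hdet).1.1 ℓ hℓ

/-! ## §4 Showcase: `E₃ : y² = x³ − 9x` — rank `0` and `Ш[2^∞] = 0` unconditionally; BSD modulo the journal facts only -/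

/-- **`#Sel⁽²⁾(E₃/ℚ) = 4`, `rk E₃(ℚ) = 0` and `Ш(E₃)[2^∞] = 0` — UNCONDITIONALLY** (`det M = 1` for `D = 3` by `decide`,
`det_monskyMatrixOdd_three`; the rank half is Genocchi's / Knapp's, the `Ш` half is new in the tree).
[cite: HeathBrown1994SelmerCongruentII, §1 typescript p. 6 L26–L28] [cite: Knapp1993, Prop. 4.23] [cite: SilvermanAEC2009, Thm. X.4.2] -/
theorem rank_zero_sha_two_congruentNumberCurve_three :
    haveI := isElliptic_congruentNumberCurve (n := 3) (by norm_num)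
    Nat.card ((congruentNumberCurve 3).selmerGroup 2) = 4 ∧ (congruentNumberCurve 3).mordellWeilRank = 0 ∧
      AddCommGroup.primaryComponent (congruentNumberCurve 3).sha 2 = ⊥ := by
  have hp : ∀ i, ((![3] : Fin 1 → ℕ) i).Prime := fun i => by fin_cases i; exact Nat.prime_three
  have hodd : ∀ i, Odd ((![3] : Fin 1 → ℕ) i) := fun i => by fin_cases i; exact Nat.odd_iff.mpr rfl
  have hinj : Function.Injective (![3] : Fin 1 → ℕ) := Function.injective_of_subsingleton _
  have h1 : Nat.card ((congruentNumberCurve 3).selmerGroup 2) = 4 :=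
    card_selmerGroup_two_eq_four_of_det_odd' ![3] (by simp) hp hodd hinj det_monskyMatrixOdd_three
  exact ⟨h1, Smith2016.mordellWeilRank_eq_zero_of_card_selmerGroup_two (by norm_num) h1,
    Smith2016.primaryComponent_sha_two_eq_bot_of_card_selmerGroup_two (by norm_num) h1⟩

/-- **Showcase on the journal door WITHOUT Monsky's fact**: `y² = x³ − 9x` satisfies RANK ∧ SHAFIN ∧ LEAD with rank `0`
modulo the three JOURNAL facts only (Burungale–Tian, Deuring–Hecke, Burungale–Flach).
[cite: BurungaleTian2026, Thm. 1.1] [cite: BurungaleFlach2024, Thm. 1.1 and Cor. 2] [cite: HeathBrown1994SelmerCongruentII, §1 typescript p. 6 L26–L28] -/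
theorem bsdTriple_congruentNumberCurve_three_descent
    (hBT : burungaleTian_analyticRank_eq_zero_of_selmerCorank_eq_zero_of_hasCM)
    (hH : hasEntireLFunction_of_j_mem_maximalCMJInvariants)
    (hBF : bsdTriple_of_hasCM_of_L_one_ne_zero) :
    haveI := isElliptic_congruentNumberCurve (n := 3) (by norm_num)
    haveI := isGloballyMinimal_congruentNumberCurve (n := 3) Nat.prime_three.squarefree
    (congruentNumberCurve 3).BSDTriple ∧ (congruentNumberCurve 3).mordellWeilRank = 0 ∧
      (congruentNumberCurve 3).analyticRank = 0 := by
  have hprod : (∏ i, (![3] : Fin 1 → ℕ) i) = 3 := by simp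
  have h := bsdTriple_of_smith_odd_descent ![3]
    (Smith2016.cor13_bsd_of_selmerRankTwo_of_burungaleTian_of_burungaleFlach hBT hH hBF)
    (fun i => by fin_cases i; exact Nat.prime_three) (fun i => by fin_cases i; exact Nat.odd_iff.mpr rfl)
    (Function.injective_of_subsingleton _) det_monskyMatrixOdd_three
  simp only [hprod] at h
  convert h using 2

end CongruentNumberMonskySelmer

end Literature.NumberTheory.EllipticCurves

end
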